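import Summits.QuantumFields.BalabanUV.T4Continuum.Support.NE9KerChartCauchyPointwise
import Summits.QuantumFields.BalabanUV.T4Continuum.Support.NE9CurChartOneInstanceSmallBonds

/-!
# NE9KerChartCauchyOneInstance — THE KERNEL SPECIES' CAUCHY CORE AT THE ONE-INSTANCE CHART OF `cur U` (the chart the joint MODEL pins for BOTH
# species — BINDER-row OWNER t4-ne9-p1 g82's answer W-ne9p1-g82-3: «print's (4.2) differentiates E^{(j)}(X, U_j(□₀, exp iB)) = E^{(j)}(X, exp iξH_j(□₀,B))
# — the SAME minimizer chart that the `cur` species is built on; so in the joint MODEL `ker` and `cur` share ONE chart, i.e. the ONE-INSTANCE chart of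
# (SB-A) §1»): ne9-leaf-05's `NE9CurChartOneInstanceSmallBonds.cur_chart_exists_oneInstance_smallJ_of_small_bonds[_unitary]` EXTENDED CONSERVATIVELY by
# the every-index-tuple and the volume-free bilocalized `(p, q)` kernel bounds of `NE9KerChartCauchyPointwise` §2 — ONE destructuring then serves the
# `cur` face ((SB-C)∕(M)) AND the `ker` face; cell `pub-balaban`, T4-DAG §2 node U3 ∕ §6 NE9, WALL-NE9-P1 §3 (ii); Summits-side NEW leaf by NE9 leaf-01
# (`b2b-balaban-t4-ne9-formalise-leaf-01`, gen 77) under an INTERFACE REQUEST NE9 of this generation (ruling e34b3e0c (0) — requested: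
# `NE9KerChartCauchyOneInstance.kerCauchy_pointwise_oneInstance_of_small_bonds[_unitary]`; first refusal ne9-leaf-05 (host) and the OWNER); nothing
# printed asserted

HONEST FRAMING (T4-DAG PAGE 1).  Rung (B)+1 of the FINITE-VOLUME T⁴ programme — NOT infinite volume, NOT a mass gap, NOT the Clay problem.  NE9 is a cell
NEW ESTIMATE, NOT PRINTED in [I] = [Balaban1987RG1] ∕ [II] = [Balaban1988RG2Cluster], NOT PROVED here («NE9 ⇐ the named binders»; spine PROVED 0∕9).
HONEST DEPENDENCY (cell line, verbatim): continuum YM on T⁴ ⇐ BetaPertH ∧ nine spine estimates (0/9 proved); BetaPertH ⇐ (D1) ∧ (D4) ∧ CAP+tail;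
G-an2-4 gates asym, D1 and NE2/3/4.  THIS FILE: the ANALYTICITY half of (K) `kerBound` ([I] (4.5) p. 282, (4.22) p. 286) AT THE ONE-INSTANCE CHART,
per `(p, q)`, print's volume-free currency `|B|²|δB(p)||B′(q)|`; the DECAY half ([Balaban1985Variational] (189)–(190)) is the T-row and is NOT here.

WHAT THIS FILE PROVES (0 def, 0 sorry, axioms standard; composition BY NAME).  **`kerCauchy_pointwise_oneInstance_of_small_bonds`** — (SB-A) §1's binders
VERBATIM (`∃ ε₃ ≤ ε_reg(d,L)`, `a_C ε_C a₃ C₄ ε₄ R_b R′`, `0 < j₁ ≤ M_J` before `∀ U`; `U(b) ∈ U1`, `‖U(b) − 1‖ ≤ ε ≤ ε₃`, `hRS`; the V₀-slot; `‖J‖ ≤ j₁`,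
`‖Δπ‖ ≤ M_Δ`), conclusion `∃ hpos, let Hc Gc Cx; QuadAnalytic (W80 …) C₄ a₃ ∧ ‖Gc ∘L L_J‖ ≤ ½ ∧ (Ψ1) ∧ (Ψ2) ∧ (Ψ3)` — (SB-A)'s package KEPT — `∧ ∀ F M,
DifferentiableOn ℂ F (ball 0 R′) → (‖F‖ ≤ M there) → ∀ 0 < r < R_b, (∀ n xs b, ‖kernelE n (F ∘ chart ∘ e.symm) 0 xs b‖ ≤ M(n∕r)ⁿ∏‖b_k‖) ∧ (∀ δB B B′ p q,
‖Σ_{x₁,x₂} kernelE 4 (F ∘ chart ∘ e.symm) 0 [p,x₁,x₂,q][δB p,B x₁,B x₂,B′ q]‖ ≤ M(4∕r)⁴(‖δB p‖·‖B‖²·‖B′ q‖))` (the Cauchy radius is `r` — (SB-A)'s `ρ` is the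
(L3) operator letter); **`…_unitary`** — (SB-A) §2's binders (unitary `U`, tracial `τ`, the norming).  Proof: (SB-A) destructured once, then ONE call each of
`NE9KerChartCauchyPointwise.norm_kernelE_chart_apply_le` ∕ `norm_sum_sum_kernelE_four_chart_le`.
DISGUISE TEST: composition of landed theorems; finite-lattice numbers ((SB-A)'s); NOT print's uniformity in the lattice, NOT the decay of (4.5)∕(4.22), NOT
(4.17)–(4.18), NOT `ker`'s definition, NOT (K)∕(4.22) as printed; not NE9.  Imports `Support.NE9KerChartCauchyPointwise` (this lineage, p330777) +
`Support.NE9CurChartOneInstanceSmallBonds` ((SB-A), ne9-leaf-05) ONLY; modifies nothing; no END re-wired.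
-/

noncomputable section

open Metric Set Finset
open scoped BigOperators

namespace Summit.QuantumFields.BalabanUV.T4Continuum.NE9KerChartCauchyOneInstance

open Literature.MathematicalPhysics.QuantumFieldTheory.Balaban1983to89
open B11Eq103H1Complex B11Eq115Space B11Eq174Chart B12Eq419Kernel
open B11Eq111FrakG (nabla115)
open B13Contraction113 (QuadAnalytic)
open B9Eq319QprimeTorus (fineP)
open B9SectCLatticeCarrier (Bond)
open B7Prop1Explicit (U1)
open B9Eq315QTorus (laplaceAofBackground)
open B9Eq315QTorusOnto (QtorusW_surjective)
open B9Eq310HessianOperator (adTransportW)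
open B9Eq335SmallBondsData (perCfg_mem_U1 hreg_of_small_bonds alpha_le_64 alphaL_le_half)
open B11Eq44COperatorTorus (Cc)
open B11Eq80Current (W80)
open B11Eq79LinearTerm (LJ)
open B11Eq63V0GroupCurrent (curV0)
open Summit.QuantumFields.BalabanUV.T4Continuum.NE9KerChartCauchyPointwise (norm_kernelE_chart_apply_le norm_sum_sum_kernelE_four_chart_le)
open Summit.QuantumFields.BalabanUV.T4Continuum.NE9CurChartOneInstanceSmallBonds (cur_chart_exists_oneInstance_smallJ_of_small_bonds
  cur_chart_exists_oneInstance_smallJ_of_small_bonds_unitary)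

set_option maxRecDepth 8192 in
/-- **THE ONE-INSTANCE CHART OF `cur U` WITH THE KERNEL SPECIES' CAUCHY CORE ATTACHED** — (SB-A) §1 verbatim ((SB-A)'s package `QuadAnalytic ∧
‖𝔊 ∘L L_J‖ ≤ ½ ∧ (Ψ1) ∧ (Ψ2) ∧ (Ψ3)` KEPT as conjuncts), plus, for every old term `F : Space115 … (∇_U) → ℂ` holomorphic on `ball 0 R′` with `‖F‖ ≤ M` there
and every Cauchy radius `0 < r < R_b`: the every-index-tuple bound `M(n∕r)ⁿ∏‖b_k‖` and the volume-free bilocalized term bound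
`‖Σ_{x₁,x₂}(…)‖ ≤ M(4∕r)⁴‖δB(p)‖‖B‖²‖B′(q)‖` for the kernels of `F ∘ chart ∘ e.symm` at `0`. [folklore] -/
theorem kerCauchy_pointwise_oneInstance_of_small_bonds {d : ℕ} (L : ℕ) [NeZero L] (m : Fin d → ℕ) [∀ i, NeZero (fineP L m i)]
    (hL : 1 ≤ L)
    {𝔸 : Type*} [NormedRing 𝔸] [NormedAlgebra ℂ 𝔸] [CompleteSpace 𝔸] [NormOneClass 𝔸] [StarRing 𝔸] [NormedStarGroup 𝔸] [StarModule ℂ 𝔸]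
    [FiniteDimensional ℂ 𝔸]
    {W : Type*} [NormedAddCommGroup W] [InnerProductSpace ℂ W] [FiniteDimensional ℂ W] (φ : W ≃ₗ[ℂ] 𝔸) {Mφ Mφ' : ℝ} (hMφ : 0 ≤ Mφ)
    (hMφ' : 0 ≤ Mφ') (hφ : ∀ w, ‖φ w‖ ≤ Mφ * ‖w‖) (hφ' : ∀ X, ‖φ.symm X‖ ≤ Mφ' * ‖X‖)
    (τ : 𝔸 →ₗ[ℂ] ℂ) {Cτ : ℝ} (hτ : ∀ X, ‖τ X‖ ≤ Cτ * ‖X‖) (hCτ : 0 ≤ Cτ)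
    {η : ℝ} [Fact (0 < (L : ℝ))] [Fact (0 < η)] {lev₀ : Bond d (fineP L m) → ℕ} {levB : Bond d m → ℕ} (lev₁ : Bond d (fineP L m) × Fin d → ℕ)
    (hlev : ∀ b, 1 ≤ lev₀ b) {c₀ c₁ : ℝ} [Fact (0 < c₀)] [Fact (0 < c₁)] {a : ℝ} (ha : 0 < a)
    (ρ : (𝔸 →L[ℂ] ℂ) →L[ℂ] 𝔸) (τc : 𝔸 →L[ℂ] ℂ) {CV RV MJ MΔ : ℝ} (hCV : 0 ≤ CV) (hRV : 0 < RV) (hMJ : 0 < MJ) (hMΔ : 0 ≤ MΔ) :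
    ∃ ε₃ aC εC a₃ C₄ ε₄ Rb R' j₁ : ℝ, 0 < ε₃ ∧ ε₃ ≤ 1 / (256 * ((d : ℝ) + 1) ^ 2 * (L : ℝ) ^ (d + 1)) ∧
      0 < aC ∧ 0 < εC ∧ 0 < a₃ ∧ 0 ≤ C₄ ∧ 0 < ε₄ ∧ 0 < Rb ∧ 0 < R' ∧ 0 < j₁ ∧ j₁ ≤ MJ ∧
      ∀ (U : Bond d (fineP L m) → 𝔸ˣ) (hU : ∀ b, U b ∈ U1 𝔸) {ε : ℝ} (hε : 0 ≤ ε)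
        (hεr : ε ≤ 1 / (256 * ((d : ℝ) + 1) ^ 2 * (L : ℝ) ^ (d + 1))), ε ≤ ε₃ → ∀ (hUε : ∀ b, ‖(U b : 𝔸) - 1‖ ≤ ε),
        (∀ (b : Bond d (fineP L m)) (v u : W), inner ℂ (adTransportW φ U b v) u = inner ℂ v (adTransportW φ (fun b => (U b)⁻¹) b u)) →
        (∀ Y : Space115 (L : ℝ) η lev₀ lev₁ (nabla115 η U), ‖Y‖ < RV →
          ‖curV0 (lev₁ := lev₁) (Dc := nabla115 η U) ρ τc U Y‖ ≤ CV * ‖Y‖ ^ 2) →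
      ∀ (J : NegSize (L : ℝ) η lev₀ 3 𝔸) (Δπ : Space115 (L : ℝ) η lev₀ lev₁ (nabla115 η U) →L[ℂ] NegSize (L : ℝ) η lev₀ 3 𝔸),
        ‖J‖ ≤ j₁ → ‖Δπ‖ ≤ MΔ →
      ∃ hpos : ∀ x : BondL2K ℂ d (fineP L m) c₀ W, x ≠ 0 →
          0 < RCLike.re (inner ℂ x (laplaceAofBackground L m hL φ U (alpha_le_64 hL hε hεr) (perCfg_mem_U1 L m hU)
            (hreg_of_small_bonds L m hU hε hUε) τ η (c₀ := c₀) (c₁ := c₁) a x)),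
      let Hc := H1LatticeCLM (lev₀ := lev₀) (levB := levB) φ hpos (QtorusW_surjective L m hL U (alpha_le_64 hL hε hεr) (perCfg_mem_U1 L m hU)
        (hreg_of_small_bonds L m hU hε hUε) (alphaL_le_half hL hεr) φ) lev₁ (nabla115 η U)
      let Gc := frakGLatticeCLM (lev₀ := lev₀) φ hpos (QtorusW_surjective L m hL U (alpha_le_64 hL hε hεr) (perCfg_mem_U1 L m hU)
        (hreg_of_small_bonds L m hU hε hUε) (alphaL_le_half hL hεr) φ) lev₁ (nabla115 η U)
      let Cx := Cc L m η U lev₀ lev₁ (nabla115 η U) levB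
      QuadAnalytic (W80 ρ τc U Hc Cx εC J Δπ) C₄ a₃ ∧ ‖Gc.comp (LJ ρ τc Hc Cx J)‖ ≤ 1 / 2 ∧
      DifferentiableOn ℂ (chartHB Gc (-(Gc.comp (LJ ρ τc Hc Cx J))) (W80 ρ τc U Hc Cx εC J Δπ) 0
          (fun A' => A' + solA Hc 0 Cx 0 εC A') ε₄ Hc) (ball (0 : NegSize (L : ℝ) η levB 0 𝔸) Rb) ∧
      MapsTo (chartHB Gc (-(Gc.comp (LJ ρ τc Hc Cx J))) (W80 ρ τc U Hc Cx εC J Δπ) 0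
          (fun A' => A' + solA Hc 0 Cx 0 εC A') ε₄ Hc) (ball (0 : NegSize (L : ℝ) η levB 0 𝔸) Rb)
          (ball (0 : Space115 (L : ℝ) η lev₀ lev₁ (nabla115 η U)) R') ∧
      chartHB Gc (-(Gc.comp (LJ ρ τc Hc Cx J))) (W80 ρ τc U Hc Cx εC J Δπ) 0
          (fun A' => A' + solA Hc 0 Cx 0 εC A') ε₄ Hc 0 = 0 ∧
      ∀ (F' : Space115 (L : ℝ) η lev₀ lev₁ (nabla115 η U) → ℂ) (M : ℝ),
        DifferentiableOn ℂ F' (ball (0 : Space115 (L : ℝ) η lev₀ lev₁ (nabla115 η U)) R') →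
        (∀ y ∈ ball (0 : Space115 (L : ℝ) η lev₀ lev₁ (nabla115 η U)) R', ‖F' y‖ ≤ M) →
        ∀ {r : ℝ}, 0 < r → r < Rb →
      (∀ (n : ℕ) (xs : Fin n → Bond d m) (b : Fin n → 𝔸),
        ‖kernelE (𝕜 := ℂ) n (F' ∘ chartHB Gc (-(Gc.comp (LJ ρ τc Hc Cx J))) (W80 ρ τc U Hc Cx εC J Δπ) 0
            (fun A' => A' + solA Hc 0 Cx 0 εC A') ε₄ Hc ∘
          (NegSup.continuousLinearEquiv ℂ (levWeight (L : ℝ) η levB 0) (V := 𝔸)).symm) 0 xs b‖ ≤ M * ((n : ℝ) / r) ^ n * ∏ k, ‖b k‖) ∧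
      (∀ (δB B B' : Bond d m → 𝔸) (p q : Bond d m),
        ‖∑ x₁, ∑ x₂, kernelE (𝕜 := ℂ) 4 (F' ∘ chartHB Gc (-(Gc.comp (LJ ρ τc Hc Cx J))) (W80 ρ τc U Hc Cx εC J Δπ) 0
            (fun A' => A' + solA Hc 0 Cx 0 εC A') ε₄ Hc ∘
          (NegSup.continuousLinearEquiv ℂ (levWeight (L : ℝ) η levB 0) (V := 𝔸)).symm) 0 ![p, x₁, x₂, q] ![δB p, B x₁, B x₂, B' q]‖ ≤
          M * ((4 : ℝ) / r) ^ 4 * (‖δB p‖ * ‖B‖ ^ 2 * ‖B' q‖)) := by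
  obtain ⟨ε₃, aC, εC, a₃, C₄, ε₄, Rb, R', j₁, hε₃, hle, haC, hεC, ha₃, hC₄, hε₄, hRb, hR', hj₁, hj₁M, H⟩ :=
    cur_chart_exists_oneInstance_smallJ_of_small_bonds L m hL φ hMφ hMφ' hφ hφ' τ hτ hCτ (η := η) (lev₀ := lev₀) (levB := levB) lev₁ hlev
      (c₀ := c₀) (c₁ := c₁) ha ρ τc hCV hRV hMJ hMΔ
  refine ⟨ε₃, aC, εC, a₃, C₄, ε₄, Rb, R', j₁, hε₃, hle, haC, hεC, ha₃, hC₄, hε₄, hRb, hR', hj₁, hj₁M, ?_⟩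
  intro U hU ε hε hεr hεm hUε hRS hqV J Δπ hJ hΔ
  obtain ⟨hpos, hqa, hop, hΨ1, hΨ2, hΨ3⟩ := H U hU hε hεr hεm hUε hRS hqV J Δπ hJ hΔ
  refine ⟨hpos, hqa, hop, hΨ1, hΨ2, hΨ3, fun F' M hF hM r hr hrR => ⟨fun n xs b => ?_, fun δB B B' p q => ?_⟩⟩
  · exact norm_kernelE_chart_apply_le (L := (L : ℝ)) (η := η) (lev := levB) hΨ1 hΨ2 hF hM hr hrR n xs b
  · exact norm_sum_sum_kernelE_four_chart_le (L := (L : ℝ)) (η := η) (lev := levB) hΨ1 hΨ2 hF hM hr hrR δB B B' p q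

set_option maxRecDepth 8192 in
/-- **The same with `hRS` DISCHARGED BY THE MODEL LETTERS** ((SB-A) §2's binders: unitary bond variables `U(b)* = U(b)⁻¹`, tracial `τ`, the norming
`⟨φ⁻¹X, φ⁻¹Y⟩ = τ(X*Y)`): the one-instance chart package + the kernel species' Cauchy core for EVERY unit-bounded unitary small-bond background. [folklore] -/
theorem kerCauchy_pointwise_oneInstance_of_small_bonds_unitary {d : ℕ} (L : ℕ) [NeZero L] (m : Fin d → ℕ) [∀ i, NeZero (fineP L m i)]
    (hL : 1 ≤ L)
    {𝔸 : Type*} [NormedRing 𝔸] [NormedAlgebra ℂ 𝔸] [CompleteSpace 𝔸] [NormOneClass 𝔸] [StarRing 𝔸] [NormedStarGroup 𝔸] [StarModule ℂ 𝔸]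
    [FiniteDimensional ℂ 𝔸]
    {W : Type*} [NormedAddCommGroup W] [InnerProductSpace ℂ W] [FiniteDimensional ℂ W] (φ : W ≃ₗ[ℂ] 𝔸) {Mφ Mφ' : ℝ} (hMφ : 0 ≤ Mφ)
    (hMφ' : 0 ≤ Mφ') (hφ : ∀ w, ‖φ w‖ ≤ Mφ * ‖w‖) (hφ' : ∀ X, ‖φ.symm X‖ ≤ Mφ' * ‖X‖)
    (τ : 𝔸 →ₗ[ℂ] ℂ) {Cτ : ℝ} (hτ : ∀ X, ‖τ X‖ ≤ Cτ * ‖X‖) (hCτ : 0 ≤ Cτ)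
    (hτφ : ∀ X Y : 𝔸, inner ℂ (φ.symm X) (φ.symm Y) = τ (star X * Y)) (htr : ∀ X Y : 𝔸, τ (X * Y) = τ (Y * X))
    {η : ℝ} [Fact (0 < (L : ℝ))] [Fact (0 < η)] {lev₀ : Bond d (fineP L m) → ℕ} {levB : Bond d m → ℕ} (lev₁ : Bond d (fineP L m) × Fin d → ℕ)
    (hlev : ∀ b, 1 ≤ lev₀ b) {c₀ c₁ : ℝ} [Fact (0 < c₀)] [Fact (0 < c₁)] {a : ℝ} (ha : 0 < a)
    (ρ : (𝔸 →L[ℂ] ℂ) →L[ℂ] 𝔸) (τc : 𝔸 →L[ℂ] ℂ) {CV RV MJ MΔ : ℝ} (hCV : 0 ≤ CV) (hRV : 0 < RV) (hMJ : 0 < MJ) (hMΔ : 0 ≤ MΔ) :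
    ∃ ε₃ aC εC a₃ C₄ ε₄ Rb R' j₁ : ℝ, 0 < ε₃ ∧ ε₃ ≤ 1 / (256 * ((d : ℝ) + 1) ^ 2 * (L : ℝ) ^ (d + 1)) ∧
      0 < aC ∧ 0 < εC ∧ 0 < a₃ ∧ 0 ≤ C₄ ∧ 0 < ε₄ ∧ 0 < Rb ∧ 0 < R' ∧ 0 < j₁ ∧ j₁ ≤ MJ ∧
      ∀ (U : Bond d (fineP L m) → 𝔸ˣ) (hU : ∀ b, U b ∈ U1 𝔸) {ε : ℝ} (hε : 0 ≤ ε)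
        (hεr : ε ≤ 1 / (256 * ((d : ℝ) + 1) ^ 2 * (L : ℝ) ^ (d + 1))), ε ≤ ε₃ → ∀ (hUε : ∀ b, ‖(U b : 𝔸) - 1‖ ≤ ε),
        (∀ b, star (U b : 𝔸) = (((U b)⁻¹ : 𝔸ˣ) : 𝔸)) →
        (∀ Y : Space115 (L : ℝ) η lev₀ lev₁ (nabla115 η U), ‖Y‖ < RV →
          ‖curV0 (lev₁ := lev₁) (Dc := nabla115 η U) ρ τc U Y‖ ≤ CV * ‖Y‖ ^ 2) →
      ∀ (J : NegSize (L : ℝ) η lev₀ 3 𝔸) (Δπ : Space115 (L : ℝ) η lev₀ lev₁ (nabla115 η U) →L[ℂ] NegSize (L : ℝ) η lev₀ 3 𝔸),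
        ‖J‖ ≤ j₁ → ‖Δπ‖ ≤ MΔ →
      ∃ hpos : ∀ x : BondL2K ℂ d (fineP L m) c₀ W, x ≠ 0 →
          0 < RCLike.re (inner ℂ x (laplaceAofBackground L m hL φ U (alpha_le_64 hL hε hεr) (perCfg_mem_U1 L m hU)
            (hreg_of_small_bonds L m hU hε hUε) τ η (c₀ := c₀) (c₁ := c₁) a x)),
      let Hc := H1LatticeCLM (lev₀ := lev₀) (levB := levB) φ hpos (QtorusW_surjective L m hL U (alpha_le_64 hL hε hεr) (perCfg_mem_U1 L m hU)
        (hreg_of_small_bonds L m hU hε hUε) (alphaL_le_half hL hεr) φ) lev₁ (nabla115 η U)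
      let Gc := frakGLatticeCLM (lev₀ := lev₀) φ hpos (QtorusW_surjective L m hL U (alpha_le_64 hL hε hεr) (perCfg_mem_U1 L m hU)
        (hreg_of_small_bonds L m hU hε hUε) (alphaL_le_half hL hεr) φ) lev₁ (nabla115 η U)
      let Cx := Cc L m η U lev₀ lev₁ (nabla115 η U) levB
      QuadAnalytic (W80 ρ τc U Hc Cx εC J Δπ) C₄ a₃ ∧ ‖Gc.comp (LJ ρ τc Hc Cx J)‖ ≤ 1 / 2 ∧
      DifferentiableOn ℂ (chartHB Gc (-(Gc.comp (LJ ρ τc Hc Cx J))) (W80 ρ τc U Hc Cx εC J Δπ) 0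
          (fun A' => A' + solA Hc 0 Cx 0 εC A') ε₄ Hc) (ball (0 : NegSize (L : ℝ) η levB 0 𝔸) Rb) ∧
      MapsTo (chartHB Gc (-(Gc.comp (LJ ρ τc Hc Cx J))) (W80 ρ τc U Hc Cx εC J Δπ) 0
          (fun A' => A' + solA Hc 0 Cx 0 εC A') ε₄ Hc) (ball (0 : NegSize (L : ℝ) η levB 0 𝔸) Rb)
          (ball (0 : Space115 (L : ℝ) η lev₀ lev₁ (nabla115 η U)) R') ∧
      chartHB Gc (-(Gc.comp (LJ ρ τc Hc Cx J))) (W80 ρ τc U Hc Cx εC J Δπ) 0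
          (fun A' => A' + solA Hc 0 Cx 0 εC A') ε₄ Hc 0 = 0 ∧
      ∀ (F' : Space115 (L : ℝ) η lev₀ lev₁ (nabla115 η U) → ℂ) (M : ℝ),
        DifferentiableOn ℂ F' (ball (0 : Space115 (L : ℝ) η lev₀ lev₁ (nabla115 η U)) R') →
        (∀ y ∈ ball (0 : Space115 (L : ℝ) η lev₀ lev₁ (nabla115 η U)) R', ‖F' y‖ ≤ M) →
        ∀ {r : ℝ}, 0 < r → r < Rb →
      (∀ (n : ℕ) (xs : Fin n → Bond d m) (b : Fin n → 𝔸),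
        ‖kernelE (𝕜 := ℂ) n (F' ∘ chartHB Gc (-(Gc.comp (LJ ρ τc Hc Cx J))) (W80 ρ τc U Hc Cx εC J Δπ) 0
            (fun A' => A' + solA Hc 0 Cx 0 εC A') ε₄ Hc ∘
          (NegSup.continuousLinearEquiv ℂ (levWeight (L : ℝ) η levB 0) (V := 𝔸)).symm) 0 xs b‖ ≤ M * ((n : ℝ) / r) ^ n * ∏ k, ‖b k‖) ∧
      (∀ (δB B B' : Bond d m → 𝔸) (p q : Bond d m),
        ‖∑ x₁, ∑ x₂, kernelE (𝕜 := ℂ) 4 (F' ∘ chartHB Gc (-(Gc.comp (LJ ρ τc Hc Cx J))) (W80 ρ τc U Hc Cx εC J Δπ) 0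
            (fun A' => A' + solA Hc 0 Cx 0 εC A') ε₄ Hc ∘
          (NegSup.continuousLinearEquiv ℂ (levWeight (L : ℝ) η levB 0) (V := 𝔸)).symm) 0 ![p, x₁, x₂, q] ![δB p, B x₁, B x₂, B' q]‖ ≤
          M * ((4 : ℝ) / r) ^ 4 * (‖δB p‖ * ‖B‖ ^ 2 * ‖B' q‖)) := by
  obtain ⟨ε₃, aC, εC, a₃, C₄, ε₄, Rb, R', j₁, hε₃, hle, haC, hεC, ha₃, hC₄, hε₄, hRb, hR', hj₁, hj₁M, H⟩ :=
    cur_chart_exists_oneInstance_smallJ_of_small_bonds_unitary L m hL φ hMφ hMφ' hφ hφ' τ hτ hCτ hτφ htr (η := η) (lev₀ := lev₀)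
      (levB := levB) lev₁ hlev (c₀ := c₀) (c₁ := c₁) ha ρ τc hCV hRV hMJ hMΔ
  refine ⟨ε₃, aC, εC, a₃, C₄, ε₄, Rb, R', j₁, hε₃, hle, haC, hεC, ha₃, hC₄, hε₄, hRb, hR', hj₁, hj₁M, ?_⟩
  intro U hU ε hε hεr hεm hUε hUstar hqV J Δπ hJ hΔ
  obtain ⟨hpos, hqa, hop, hΨ1, hΨ2, hΨ3⟩ := H U hU hε hεr hεm hUε hUstar hqV J Δπ hJ hΔ
  refine ⟨hpos, hqa, hop, hΨ1, hΨ2, hΨ3, fun F' M hF hM r hr hrR => ⟨fun n xs b => ?_, fun δB B B' p q => ?_⟩⟩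
  · exact norm_kernelE_chart_apply_le (L := (L : ℝ)) (η := η) (lev := levB) hΨ1 hΨ2 hF hM hr hrR n xs b
  · exact norm_sum_sum_kernelE_four_chart_le (L := (L : ℝ)) (η := η) (lev := levB) hΨ1 hΨ2 hF hM hr hrR δB B B' p q

end Summit.QuantumFields.BalabanUV.T4Continuum.NE9KerChartCauchyOneInstance

end
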